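import Mathlib
import HarnessLib
import Summits.Ventures.LatticeQCDFlow.Scoring.DoeblinGreenKubo
import Summits.Ventures.LatticeQCDFlow.Exactness.ApproxTrivializingSampler

/-!
# Every bounded observable of the exact flow-MCMC sampler: `|ρ_t| ≤ (1 − e^{−M})ᵗ`,
# `τ_int ≤ e^{M} − 1/2` from the log-weight oscillation `M` (`M = 2δ` for a flow-equation defect `δ`)

HONEST FRAMING: exact (Metropolis-corrected) sampling algorithms for lattice gauge theory;
figures of merit are autocorrelation/cost numbers at stated couplings and volumes; no
continuum-physics claim.

Venture `LatticeQCDFlow` (cell pub-lqcd), topic `Scoring`; FANOUT row 8 (`s0-cpn-nemc`, GEN-10).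
NEW WORK of the cell (two `have`s), not a published result: the autocorrelation envelope of
`Scoring/DoeblinAutocorrelation.lean` (`abs_autocov_le_of_doeblin`, `tauInt_le_exp_of_doeblin`: a
Markov kernel minorised by its own invariant law, `K(x,·) ≥ ε π`, has `|C_f(t)| ≤ (1 − ε)ᵗ Var_π f`
and `τ_int(f) ≤ 1/ε − 1/2` for every bounded measurable observable) INSTANTIATED on the tree's exact
flow-MCMC theorems of `Exactness/ApproxTrivializingSampler.lean` (row 30, lean-1), whose conclusion
(iii) is exactly that minorisation with `ε = e^{−M}`:

* `indepMH_autocorrelation_of_density_ratio` (any measurable space) — target `π`, model `q = ρ · π`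
  with `ρ x ≤ e^{M} ρ y`: the independence Metropolis kernel `indepMH q (1/ρ)` (propose from the
  model, accept with `min(1, ρ(x)/ρ(y))`) has, for every bounded measurable `π`-centred `f` and every
  `t`, `|∫ f · Kᵗf dπ| ≤ (1 − e^{−M})ᵗ ∫ f² dπ` and `τ_int(f) ≤ e^{M} − 1/2`;
  `indepMH_greenKubo_of_density_ratio` — and the WINDOWLESS LAW (`Scoring/DoeblinGreenKubo.lean`):
  a bounded measurable Poisson solution `h − K h = f` exists (`|h| ≤ 2C e^{M}`),
  `Σ_t C_f(t) = ⟨f, h⟩_π` and `τ_int(f) = ⟨f, h⟩_π / Var_π f − 1/2`.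
* **`flowSampler_autocorrelation`** (lattice `SU(n)^E`, UNCONDITIONAL — the Jacobian formula (3.9) is
  the tree theorem consumed inside `flowSampler_exact_doeblin`) — smooth action `S`, jointly smooth
  flow action `S̃_t` with uniform defect `|𝓛_t S̃_t − S − Ċ_t| ≤ δ` of Lüscher's equation (4.5) on
  `[0,1] × SU(n)^E`, `𝓕` integrating `−∂S̃_t`, model `q = (𝓕_1)_* D[V]`: with the weight `w = dπ/dq`
  of that theorem the flow-MCMC kernel `indepMH q w` is exact for `π = 𝒵⁻¹e^{−S}D[U]` AND every
  bounded measurable `π`-centred observable `f` has `|C_f(t)| ≤ (1 − e^{−2δ})ᵗ · Var_π f` for all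
  `t` and `τ_int(f) ≤ e^{2δ} − 1/2` on the tree's `Scoring.tauInt`; **`flowSampler_greenKubo`** —
  for the same kernel every bounded measurable centred `f` has a bounded measurable Poisson
  solution `h` (`|h| ≤ 2C e^{2δ}`) with `Σ_t C_f(t) = ⟨f, h⟩_π` and
  `τ_int(f) = ⟨f, h⟩_π / Var_π f − 1/2` (the kernel form of IMH-LAW (T2)).

Reading (markdown): the integrated autocorrelation time of EVERY observable of the exact sampler is
bounded by a function of the flow-equation defect alone, `e^{2δ} − 1/2`, at every volume at which
the defect bound `δ` holds; how `δ` must grow with the volume / coupling for a fixed architecture is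
theory-1's subject (`TrivializingMaps/*`), not claimed here.  The finite-pool counterpart with the
SHARP constant (`sup_f τ_int = w⋆ − 1/2`) is `Scoring/IMHAutocorrelationEnvelope.lean`.
-/

noncomputable section

namespace Summit.Ventures.LatticeQCDFlow.Scoring

open MeasureTheory ProbabilityTheory Filter Summit.Ventures.LatticeQCDFlow.Exactness
open scoped ENNReal Topology

/-! ### §1 General state space: density-ratio oscillation `M` -/

section General

variable {Ω : Type*} [MeasurableSpace Ω]

/-- **Flow-MCMC with a density-ratio bound: autocorrelation envelope and `τ_int ≤ e^{M} − 1/2`.**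
Target `π`, model `q = ρ · π` (probability measures) with `ρ > 0` measurable and `ρ x ≤ e^{M} ρ y`
for all `x, y`: for the exact kernel `indepMH q (1/ρ)` and every bounded measurable `π`-centred `f`,
`|∫ f · Kᵗ f dπ| ≤ (1 − e^{−M})ᵗ ∫ f² dπ` for all `t`, `τ_int(f) ≤ e^{M} − 1/2`, and row 11's
finite-`N` variance-of-the-mean time converges, `τ_N → τ_int`. -/
theorem indepMH_autocorrelation_of_density_ratio {π q : Measure Ω} [IsProbabilityMeasure π]
    [IsProbabilityMeasure q] {ρ : Ω → ℝ} (hρm : Measurable ρ) (hρ0 : ∀ x, 0 < ρ x)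
    (hq : q = π.withDensity fun x => ENNReal.ofReal (ρ x)) {M : ℝ}
    (hM : ∀ x y, ρ x ≤ Real.exp M * ρ y) {f : Ω → ℝ} (hf : Measurable f) {C : ℝ}
    (hC : ∀ x, |f x| ≤ C) (hf0 : ∫ x, f x ∂π = 0) :
    (∀ t : ℕ, |autocov (indepMH q fun x => (ρ x)⁻¹) π f t|
        ≤ (1 - Real.exp (-M)) ^ t * ∫ x, f x ^ 2 ∂π) ∧
      tauInt (fun t => autocov (indepMH q fun x => (ρ x)⁻¹) π f t /
          autocov (indepMH q fun x => (ρ x)⁻¹) π f 0) ≤ Real.exp M - 1 / 2 ∧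
      Tendsto (fun N => tauIntN (fun t => autocov (indepMH q fun x => (ρ x)⁻¹) π f t /
          autocov (indepMH q fun x => (ρ x)⁻¹) π f 0) N) atTop
        (𝓝 (tauInt fun t => autocov (indepMH q fun x => (ρ x)⁻¹) π f t /
          autocov (indepMH q fun x => (ρ x)⁻¹) π f 0)) := by
  haveI : Fact (Measurable fun x => (ρ x)⁻¹) := ⟨hρm.inv⟩
  obtain ⟨hinv, -, hdoeb⟩ := indepMH_exact_doeblin_of_density_ratio hρm hρ0 hq hM
  have hε0 : 0 < ENNReal.ofReal (Real.exp (-M)) := ENNReal.ofReal_pos.2 (Real.exp_pos _)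
  refine ⟨fun t => ?_, tauInt_le_exp_of_doeblin hinv (fun x B hB => hdoeb x hB) hf hC hf0,
    tendsto_tauIntN_of_doeblin hinv (fun x B hB => hdoeb x hB) hε0 hf hC hf0⟩
  have h := abs_autocov_le_of_doeblin hinv (fun x B hB => hdoeb x hB) hf hC hf0 t
  rwa [ENNReal.toReal_ofReal (Real.exp_pos _).le] at h

/-- **Flow-MCMC with a density-ratio bound: the windowless τ law.**  Same setting: every bounded
measurable `π`-centred `f` (`|f| ≤ C`) has a bounded measurable Poisson solution `h − K h = f` with
`|h| ≤ 2C e^{M}`, `Σ_{t ≥ 0} ∫ f · Kᵗ f dπ = ∫ f h dπ`, and `τ_int(f) = ∫ f h dπ / ∫ f² dπ − 1/2`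
whenever `∫ f² dπ ≠ 0`. -/
theorem indepMH_greenKubo_of_density_ratio {π q : Measure Ω} [IsProbabilityMeasure π]
    [IsProbabilityMeasure q] {ρ : Ω → ℝ} (hρm : Measurable ρ) (hρ0 : ∀ x, 0 < ρ x)
    (hq : q = π.withDensity fun x => ENNReal.ofReal (ρ x)) {M : ℝ}
    (hM : ∀ x y, ρ x ≤ Real.exp M * ρ y) {f : Ω → ℝ} (hf : Measurable f) {C : ℝ}
    (hC : ∀ x, |f x| ≤ C) (hf0 : ∫ x, f x ∂π = 0) :
    ∃ h : Ω → ℝ, Measurable h ∧ (∀ x, |h x| ≤ 2 * C * Real.exp M) ∧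
      (∀ x, h x - kop (indepMH q fun x => (ρ x)⁻¹) h x = f x) ∧
      HasSum (fun t => autocov (indepMH q fun x => (ρ x)⁻¹) π f t) (∫ x, f x * h x ∂π) ∧
      (∫ x, f x ^ 2 ∂π ≠ 0 →
        tauInt (fun t => autocov (indepMH q fun x => (ρ x)⁻¹) π f t /
            autocov (indepMH q fun x => (ρ x)⁻¹) π f 0)
          = (∫ x, f x * h x ∂π) / (∫ x, f x ^ 2 ∂π) - 1 / 2) := by
  haveI : Fact (Measurable fun x => (ρ x)⁻¹) := ⟨hρm.inv⟩
  obtain ⟨hinv, -, hdoeb⟩ := indepMH_exact_doeblin_of_density_ratio hρm hρ0 hq hM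
  have hε0 : 0 < ENNReal.ofReal (Real.exp (-M)) := ENNReal.ofReal_pos.2 (Real.exp_pos _)
  obtain ⟨h, hhm, hhb, hpois⟩ :=
    poisson_exists_of_doeblin hinv (fun x B hB => hdoeb x hB) hε0 hf hC hf0
  have hb' : ∀ x, |h x| ≤ 2 * C * Real.exp M := fun x => by
    have h1 := hhb x
    rwa [ENNReal.toReal_ofReal (Real.exp_pos _).le, Real.exp_neg, div_inv_eq_mul] at h1
  exact ⟨h, hhm, hb', hpois,
    greenKubo_hasSum_of_poisson hinv (fun x B hB => hdoeb x hB) hε0 hf hC hf0 hhm hb' hpois,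
    fun hV => tauInt_eq_of_poisson hinv (fun x B hB => hdoeb x hB) hε0 hf hC hf0 hhm hb' hpois hV⟩

end General

/-! ### §2 The lattice: flow-equation defect `δ` -/

section Lattice

open Literature.MathematicalPhysics.QuantumFieldTheory
open Literature.MathematicalPhysics.QuantumFieldTheory.Luscher2010
open Summit.Ventures.LatticeQCDFlow.TrivializingMaps
open scoped Matrix Matrix.Norms.Frobenius ContDiff

variable {d L n : ℕ} [NeZero L]

/-- **Autocorrelations of the exact flow sampler from the flow-equation defect — UNCONDITIONAL.**
Smooth action `S`, jointly smooth flow action `S̃_t = F t` with uniform defect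
`|𝓛_t S̃_t − S − Ċ_t| ≤ δ` of Lüscher's equation (4.5) on `[0,1] × SU(n)^E`, `𝓕` integrating `−∂S̃_t`,
`q = (𝓕_1)_* D[V]`: there is a measurable weight `w` with `w · q = π := 𝒵⁻¹e^{−S}D[U]` such that the
flow-MCMC kernel `indepMH q w` is EXACT for `π` and, for EVERY bounded measurable `π`-centred
observable `f`: `|∫ f · Kᵗ f dπ| ≤ (1 − e^{−2δ})ᵗ · ∫ f² dπ` for all `t`,
`τ_int(f) ≤ e^{2δ} − 1/2`, and `τ_N → τ_int` (row 11's finite-`N` variance of the mean). -/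
theorem flowSampler_autocorrelation (B : SuBasis n)
    {S : AmbConfig d L n → ℝ} (hS : ContDiff ℝ ∞ S) {F : ℝ → AmbConfig d L n → ℝ}
    (hF : ContDiff ℝ ∞ fun p : ℝ × AmbConfig d L n => F p.1 p.2)
    {Φ : ℝ → GaugeConfig d L (Matrix.specialUnitaryGroup (Fin n) ℂ) →
      GaugeConfig d L (Matrix.specialUnitaryGroup (Fin n) ℂ)}
    (hΦ : IsFlowMap (fun t W => -linkGrad B (F t) W) Φ) {c : ℝ → ℝ} {δ : ℝ}
    (hδ : ∀ t ∈ Set.Icc (0 : ℝ) 1, ∀ U : GaugeConfig d L (Matrix.specialUnitaryGroup (Fin n) ℂ),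
      |luscherL B S t (F t) (WilsonFlow.coeConfig U) - S (WilsonFlow.coeConfig U) - c t| ≤ δ)
    (q : Measure (GaugeConfig d L (Matrix.specialUnitaryGroup (Fin n) ℂ))) [IsProbabilityMeasure q]
    (hq : q = Measure.map (Φ 1) (trivialMeasure (Matrix.specialUnitaryGroup (Fin n) ℂ) d L)) :
    ∃ w : GaugeConfig d L (Matrix.specialUnitaryGroup (Fin n) ℂ) → ℝ, Measurable w ∧
      (q.withDensity fun U => ENNReal.ofReal (w U)) =
        boltzmannMeasure (fun U : GaugeConfig d L (Matrix.specialUnitaryGroup (Fin n) ℂ) =>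
          S (WilsonFlow.coeConfig U)) ∧
      Kernel.Invariant (indepMH q w)
        (boltzmannMeasure fun U : GaugeConfig d L (Matrix.specialUnitaryGroup (Fin n) ℂ) =>
          S (WilsonFlow.coeConfig U)) ∧
      ∀ (f : GaugeConfig d L (Matrix.specialUnitaryGroup (Fin n) ℂ) → ℝ), Measurable f →
        ∀ C : ℝ, (∀ U, |f U| ≤ C) →
        ∫ U, f U ∂(boltzmannMeasure fun U : GaugeConfig d L (Matrix.specialUnitaryGroup (Fin n) ℂ) =>
          S (WilsonFlow.coeConfig U)) = 0 →
        (∀ t : ℕ,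
          |autocov (indepMH q w)
              (boltzmannMeasure fun U : GaugeConfig d L (Matrix.specialUnitaryGroup (Fin n) ℂ) =>
                S (WilsonFlow.coeConfig U)) f t|
            ≤ (1 - Real.exp (-(2 * δ))) ^ t *
              ∫ U, f U ^ 2 ∂(boltzmannMeasure fun U :
                GaugeConfig d L (Matrix.specialUnitaryGroup (Fin n) ℂ) => S (WilsonFlow.coeConfig U))) ∧
        tauInt (fun t =>
            autocov (indepMH q w)
                (boltzmannMeasure fun U : GaugeConfig d L (Matrix.specialUnitaryGroup (Fin n) ℂ) =>
                  S (WilsonFlow.coeConfig U)) f t /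
              autocov (indepMH q w)
                (boltzmannMeasure fun U : GaugeConfig d L (Matrix.specialUnitaryGroup (Fin n) ℂ) =>
                  S (WilsonFlow.coeConfig U)) f 0)
          ≤ Real.exp (2 * δ) - 1 / 2 ∧
        Tendsto (fun N => tauIntN (fun t =>
            autocov (indepMH q w)
                (boltzmannMeasure fun U : GaugeConfig d L (Matrix.specialUnitaryGroup (Fin n) ℂ) =>
                  S (WilsonFlow.coeConfig U)) f t /
              autocov (indepMH q w)
                (boltzmannMeasure fun U : GaugeConfig d L (Matrix.specialUnitaryGroup (Fin n) ℂ) =>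
                  S (WilsonFlow.coeConfig U)) f 0) N) atTop
          (𝓝 (tauInt fun t =>
            autocov (indepMH q w)
                (boltzmannMeasure fun U : GaugeConfig d L (Matrix.specialUnitaryGroup (Fin n) ℂ) =>
                  S (WilsonFlow.coeConfig U)) f t /
              autocov (indepMH q w)
                (boltzmannMeasure fun U : GaugeConfig d L (Matrix.specialUnitaryGroup (Fin n) ℂ) =>
                  S (WilsonFlow.coeConfig U)) f 0)) := by
  obtain ⟨w, hw, -, -, hπ, hinv, -, hdoeb⟩ := flowSampler_exact_doeblin B hS hF hΦ hδ q hq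
  haveI : Fact (Measurable w) := ⟨hw⟩
  have hS'c : Continuous fun U : GaugeConfig d L (Matrix.specialUnitaryGroup (Fin n) ℂ) =>
      S (WilsonFlow.coeConfig U) := hS.continuous.comp WilsonFlow.continuous_coeConfig
  haveI := isProbabilityMeasure_boltzmannMeasure (d := d) (L := L) hS'c
  have hε0 : 0 < ENNReal.ofReal (Real.exp (-(2 * δ))) := ENNReal.ofReal_pos.2 (Real.exp_pos _)
  refine ⟨w, hw, hπ, hinv, fun f hf C hC hf0 => ⟨fun t => ?_, ?_,
    tendsto_tauIntN_of_doeblin hinv (fun x B hB => hdoeb x hB) hε0 hf hC hf0⟩⟩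
  · have h := abs_autocov_le_of_doeblin hinv (fun x B hB => hdoeb x hB) hf hC hf0 t
    rwa [ENNReal.toReal_ofReal (Real.exp_pos _).le] at h
  · have h := tauInt_le_exp_of_doeblin (M := 2 * δ) hinv (fun x B hB => hdoeb x hB) hf hC hf0
    exact h

/-- **The windowless τ law of the exact flow sampler — UNCONDITIONAL.**  Under the hypotheses of
`flowSampler_autocorrelation`: with the weight `w` of `flowSampler_exact_doeblin`, every bounded
measurable `π`-centred observable `f` (`|f| ≤ C`) has a bounded measurable Poisson solution
`h − K h = f` for `K = indepMH q w` with `|h| ≤ 2C e^{2δ}`, `Σ_{t ≥ 0} ∫ f · Kᵗ f dπ = ∫ f h dπ`, and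
`τ_int(f) = ∫ f h dπ / ∫ f² dπ − 1/2` whenever `∫ f² dπ ≠ 0` (`π = 𝒵⁻¹e^{−S}D[U]`). -/
theorem flowSampler_greenKubo (B : SuBasis n)
    {S : AmbConfig d L n → ℝ} (hS : ContDiff ℝ ∞ S) {F : ℝ → AmbConfig d L n → ℝ}
    (hF : ContDiff ℝ ∞ fun p : ℝ × AmbConfig d L n => F p.1 p.2)
    {Φ : ℝ → GaugeConfig d L (Matrix.specialUnitaryGroup (Fin n) ℂ) →
      GaugeConfig d L (Matrix.specialUnitaryGroup (Fin n) ℂ)}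
    (hΦ : IsFlowMap (fun t W => -linkGrad B (F t) W) Φ) {c : ℝ → ℝ} {δ : ℝ}
    (hδ : ∀ t ∈ Set.Icc (0 : ℝ) 1, ∀ U : GaugeConfig d L (Matrix.specialUnitaryGroup (Fin n) ℂ),
      |luscherL B S t (F t) (WilsonFlow.coeConfig U) - S (WilsonFlow.coeConfig U) - c t| ≤ δ)
    (q : Measure (GaugeConfig d L (Matrix.specialUnitaryGroup (Fin n) ℂ))) [IsProbabilityMeasure q]
    (hq : q = Measure.map (Φ 1) (trivialMeasure (Matrix.specialUnitaryGroup (Fin n) ℂ) d L)) :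
    ∃ w : GaugeConfig d L (Matrix.specialUnitaryGroup (Fin n) ℂ) → ℝ, Measurable w ∧
      (q.withDensity fun U => ENNReal.ofReal (w U)) =
        boltzmannMeasure (fun U : GaugeConfig d L (Matrix.specialUnitaryGroup (Fin n) ℂ) =>
          S (WilsonFlow.coeConfig U)) ∧
      ∀ (f : GaugeConfig d L (Matrix.specialUnitaryGroup (Fin n) ℂ) → ℝ), Measurable f →
        ∀ C : ℝ, (∀ U, |f U| ≤ C) →
        ∫ U, f U ∂(boltzmannMeasure fun U : GaugeConfig d L (Matrix.specialUnitaryGroup (Fin n) ℂ) =>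
          S (WilsonFlow.coeConfig U)) = 0 →
        ∃ h : GaugeConfig d L (Matrix.specialUnitaryGroup (Fin n) ℂ) → ℝ, Measurable h ∧
          (∀ U, |h U| ≤ 2 * C * Real.exp (2 * δ)) ∧
          (∀ U, h U - kop (indepMH q w) h U = f U) ∧
          HasSum (fun t => autocov (indepMH q w)
              (boltzmannMeasure fun U : GaugeConfig d L (Matrix.specialUnitaryGroup (Fin n) ℂ) =>
                S (WilsonFlow.coeConfig U)) f t)
            (∫ U, f U * h U ∂(boltzmannMeasure fun U :
              GaugeConfig d L (Matrix.specialUnitaryGroup (Fin n) ℂ) => S (WilsonFlow.coeConfig U))) ∧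
          (∫ U, f U ^ 2 ∂(boltzmannMeasure fun U :
              GaugeConfig d L (Matrix.specialUnitaryGroup (Fin n) ℂ) => S (WilsonFlow.coeConfig U)) ≠ 0 →
            tauInt (fun t =>
                autocov (indepMH q w)
                    (boltzmannMeasure fun U : GaugeConfig d L (Matrix.specialUnitaryGroup (Fin n) ℂ) =>
                      S (WilsonFlow.coeConfig U)) f t /
                  autocov (indepMH q w)
                    (boltzmannMeasure fun U : GaugeConfig d L (Matrix.specialUnitaryGroup (Fin n) ℂ) =>
                      S (WilsonFlow.coeConfig U)) f 0)
              = (∫ U, f U * h U ∂(boltzmannMeasure fun U :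
                  GaugeConfig d L (Matrix.specialUnitaryGroup (Fin n) ℂ) => S (WilsonFlow.coeConfig U))) /
                (∫ U, f U ^ 2 ∂(boltzmannMeasure fun U :
                  GaugeConfig d L (Matrix.specialUnitaryGroup (Fin n) ℂ) => S (WilsonFlow.coeConfig U)))
                - 1 / 2) := by
  obtain ⟨w, hw, -, -, hπ, hinv, -, hdoeb⟩ := flowSampler_exact_doeblin B hS hF hΦ hδ q hq
  haveI : Fact (Measurable w) := ⟨hw⟩
  have hS'c : Continuous fun U : GaugeConfig d L (Matrix.specialUnitaryGroup (Fin n) ℂ) =>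
      S (WilsonFlow.coeConfig U) := hS.continuous.comp WilsonFlow.continuous_coeConfig
  haveI := isProbabilityMeasure_boltzmannMeasure (d := d) (L := L) hS'c
  have hε0 : 0 < ENNReal.ofReal (Real.exp (-(2 * δ))) := ENNReal.ofReal_pos.2 (Real.exp_pos _)
  refine ⟨w, hw, hπ, fun f hf C hC hf0 => ?_⟩
  obtain ⟨h, hhm, hhb, hpois⟩ :=
    poisson_exists_of_doeblin hinv (fun x B hB => hdoeb x hB) hε0 hf hC hf0
  have hb' : ∀ U, |h U| ≤ 2 * C * Real.exp (2 * δ) := fun U => by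
    have h1 := hhb U
    rwa [ENNReal.toReal_ofReal (Real.exp_pos _).le, Real.exp_neg, div_inv_eq_mul] at h1
  exact ⟨h, hhm, hb', hpois,
    greenKubo_hasSum_of_poisson hinv (fun x B hB => hdoeb x hB) hε0 hf hC hf0 hhm hb' hpois,
    fun hV => tauInt_eq_of_poisson hinv (fun x B hB => hdoeb x hB) hε0 hf hC hf0 hhm hb' hpois hV⟩

end Lattice

end Summit.Ventures.LatticeQCDFlow.Scoring

end
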